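import Mathlib
import Summits.KontsevichZagierPeriods.KontsevichZagierPeriods.Theorems.SoloInformedHookPlace
import Summits.KontsevichZagierPeriods.KontsevichZagierPeriods.Theorems.SoloInformedHookSeries
import HarnessLib
import HarnessLib.Audit

/-!
# SoloInformed — final states of the placement sum and their index words (hook identities F1d)

Solo programme `solo-KontsevichZagierPeriods-informed`, session s52 (PROGRAMME LIII).

File F1c (`SoloInformedHookPlace`) defined the PLACEMENT SUM `soloInformedHookSum w β K pos bs`
of the hanging coordinates `bs` into a block labelling `β` (blocks `0,…,K`, last position `pos`)
and proved its divided-difference recursion (the `B`-integrand of the iterated scale band step).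
This file ENUMERATES the final states: `soloInformedHookStates β K pos bs` lists the pairs
`(β', K')` reached by the placement process (same recursion: insert after / merge into block
`pos + s`), and

* `soloInformed_hookSum_eq_states`: `HookSum(w) = Σ_{(β',K') ∈ states} G(Q_0(w),…,Q_{K'}(w))`;
* `soloInformed_states_valid`: every final state is partially valid with
  `cum_{K'}(β') = cum_K(β) + |bs|` — so when all coordinates are placed it is a valid block
  labelling and its term is the integrand of `BRep β'`, of class `mzvClass (idx β')`
  (`SoloInformedBlockReps`);
* `soloInformed_states_words`: the index words of the final states are a pure function
  `soloInformedHookWords` (file `HookSeries`, where it is identified with Kaneko–Yamamoto's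
  `k ⊛ ((1,…,1))^★`) of the starting index word — each placed coordinate inserts a letter
  `1` after position `pos + s` or raises the entry at position `pos + s` (`s ≥ 0`), the next
  coordinate being placed from that position on.

For the chain of `ζ(u)` (`u` admissible, tree order) and `i` hanging coordinates the word list
`soloInformedHookWords u 0 i` is the right-hand side of the hook identity `HOOK(u,i)`
(Kaneko–Yamamoto's integral–series identity for `l = (1,…,1)`), e.g.
`HOOK((2),2): 3·Z(2,1,1) = Z(2,1,1) + Z(2,2) + Z(3,1) + Z(4)` (sanity checks in §3).

References: M. Kaneko, S. Yamamoto, arXiv:1605.03117, Thm 4.1, Prop. 5.4; M. Hoffman, Pacific J.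
Math. 152 (1992) §2; Kontsevich–Zagier 2001 §1.2 [KontsevichZagier2001].
-/

noncomputable section

open Literature.NumberTheory.Transcendental
open Literature.NumberTheory.Transcendental.KZ

namespace Summit.KontsevichZagierPeriods.KontsevichZagierPeriods.Theorems

/-! ## 1. The final states of the placement process -/

section states

variable {N : ℕ}

/-- **The final states.** Place the coordinates `bs` in order, starting from `(β, K, pos)`:
each is inserted after block `pos + s` (state `(PlIns, K + 1, pos + s + 1)`) or merged into
block `pos + s` (state `(PlMerge, K, pos + s)`), `0 ≤ s ≤ K − pos`; list the final `(β', K')`. -/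
def soloInformedHookStates :
    (Fin N → ℕ) → ℕ → ℕ → List (Fin N) → List ((Fin N → ℕ) × ℕ)
  | β, K, _, [] => [(β, K)]
  | β, K, pos, b :: bs =>
      (List.range (K + 1 - pos)).flatMap fun s =>
        soloInformedHookStates (soloInformedPlIns β b (pos + s)) (K + 1) (pos + s + 1) bs ++
          soloInformedHookStates (soloInformedPlMerge β b (pos + s)) K (pos + s) bs

/-- No coordinate left: the state itself. -/
@[simp] theorem soloInformedHookStates_nil (β : Fin N → ℕ) (K pos : ℕ) :
    soloInformedHookStates β K pos [] = [(β, K)] := rfl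

/-- One more coordinate: insert after / merge into block `pos + s`, `s ≤ K − pos`. -/
theorem soloInformedHookStates_cons (β : Fin N → ℕ) (K pos : ℕ) (b : Fin N)
    (bs : List (Fin N)) :
    soloInformedHookStates β K pos (b :: bs) =
      (List.range (K + 1 - pos)).flatMap fun s =>
        soloInformedHookStates (soloInformedPlIns β b (pos + s)) (K + 1) (pos + s + 1) bs ++
          soloInformedHookStates (soloInformedPlMerge β b (pos + s)) K (pos + s) bs := rfl

/-- The chain function `G(Q_0(w), …, Q_{K'}(w))` of a state `(β', K')`. -/
def soloInformedStateG (w : Fin N → ℝ) (p : (Fin N → ℕ) × ℕ) : ℝ :=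
  soloInformedGQ (List.ofFn fun t : Fin (p.2 + 1) => soloInformedBP p.1 w t)

/-- Unfolding `soloInformedStateG`. -/
theorem soloInformedStateG_apply (w : Fin N → ℝ) (β : Fin N → ℕ) (K : ℕ) :
    soloInformedStateG w (β, K) =
      soloInformedGQ (List.ofFn fun t : Fin (K + 1) => soloInformedBP β w t) := rfl

/-- **The placement sum is the sum of the chain functions of the final states.** -/
theorem soloInformed_hookSum_eq_states (w : Fin N → ℝ) :
    ∀ (bs : List (Fin N)) (β : Fin N → ℕ) (K pos : ℕ),
      soloInformedHookSum w β K pos bs =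
        ((soloInformedHookStates β K pos bs).map (soloInformedStateG w)).sum
  | [], β, K, pos => by
    rw [soloInformedHookSum_nil, soloInformedHookStates_nil, List.map_singleton,
      List.sum_singleton, soloInformedStateG_apply]
  | b :: bs, β, K, pos => by
    rw [soloInformedHookSum_cons, soloInformedHookStates_cons, soloInformed_sum_range_eq_list,
      soloInformed_sum_map_flatMap]
    congr 1
    refine List.map_congr_left fun s _ => ?_
    rw [List.map_append, List.sum_append, soloInformed_hookSum_eq_states w bs,
      soloInformed_hookSum_eq_states w bs]

/-- **Every final state is partially valid and has placed `|bs|` more coordinates:**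
`IsLabK β' K'` and `cum_{K'}(β') = cum_K(β) + |bs|` (for a partially valid start, `pos ≤ K`,
and pairwise distinct unplaced `bs`). -/
theorem soloInformed_states_valid :
    ∀ (bs : List (Fin N)) (β : Fin N → ℕ) (K pos : ℕ),
      soloInformedIsLabK β K → pos ≤ K → (∀ x ∈ bs, K < β x) → bs.Nodup →
      ∀ p ∈ soloInformedHookStates β K pos bs,
        soloInformedIsLabK p.1 p.2 ∧ soloInformedCum p.1 p.2 = soloInformedCum β K + bs.length
  | [], β, K, pos, hL, _, _, _, p, hp => by
    rw [soloInformedHookStates_nil, List.mem_singleton] at hp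
    subst hp
    exact ⟨hL, by simp⟩
  | c :: bs, β, K, pos, hL, hpos, hub, hnd, p, hp => by
    rw [soloInformedHookStates_cons, List.mem_flatMap] at hp
    obtain ⟨s, hs, hp⟩ := hp
    rw [List.mem_range] at hs
    have hs' : pos + s ≤ K := by omega
    have hcK : K < β c := hub c (by simp)
    have hcn : c ∉ bs := (List.nodup_cons.1 hnd).1
    have hnd2 : bs.Nodup := (List.nodup_cons.1 hnd).2
    have hrest : ∀ x ∈ bs, x ≠ c ∧ K < β x := fun x hx =>
      ⟨fun h => hcn (h ▸ hx), hub x (List.mem_cons_of_mem c hx)⟩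
    rw [List.mem_append] at hp
    rcases hp with hp | hp
    · have IH := soloInformed_states_valid bs (soloInformedPlIns β c (pos + s)) (K + 1)
        (pos + s + 1) (soloInformed_isLabK_plIns hcK hL hs') (by omega)
        (fun x hx => soloInformed_lt_plIns_of_ne hs' (hrest x hx).1 (hrest x hx).2) hnd2 p hp
      rw [soloInformed_cum_plIns hcK hs'] at IH
      exact ⟨IH.1, by rw [IH.2, List.length_cons]; ring⟩
    · have IH := soloInformed_states_valid bs (soloInformedPlMerge β c (pos + s)) K (pos + s)
        (soloInformed_isLabK_plMerge hcK hL) hs'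
        (fun x hx => soloInformed_lt_plMerge_of_ne (hrest x hx).1 (hrest x hx).2) hnd2 p hp
      rw [soloInformed_cum_plMerge hcK hs'] at IH
      exact ⟨IH.1, by rw [IH.2, List.length_cons]; ring⟩

/-- **All coordinates placed ⇒ every final state is a valid block labelling** (and then its
chain function is the integrand of `BRep β'`, of class `mzvClass (idx β')`,
`soloInformed_bRep_integrand` / `soloInformed_bRep_class`). -/
theorem soloInformed_states_isLab {bs : List (Fin N)} {β : Fin N → ℕ} {K pos : ℕ}
    (hL : soloInformedIsLabK β K) (hpos : pos ≤ K) (hub : ∀ x ∈ bs, K < β x) (hnd : bs.Nodup)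
    (hcum : soloInformedCum β K + bs.length = N) {p : (Fin N → ℕ) × ℕ}
    (hp : p ∈ soloInformedHookStates β K pos bs) : soloInformedIsLab p.1 p.2 := by
  have h := soloInformed_states_valid bs β K pos hL hpos hub hnd p hp
  exact soloInformed_isLab_of_cum_eq h.1 (h.2.trans hcum)

/-- On a valid final state the chain function is the integrand of `BRep β'`. -/
theorem soloInformed_stateG_eq_bRep_integrand {M : ℕ} (w : Fin (M + 1) → ℝ)
    {p : (Fin (M + 1) → ℕ) × ℕ} (hLp : soloInformedIsLab p.1 p.2) :
    soloInformedStateG w p = (soloInformedBRep p.1 hLp).integrand w := by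
  rw [soloInformed_bRep_integrand]
  rfl

end states

/-! ## 2. The index words of the final states -/

section words

variable {N : ℕ}

/-- The entries of the index, `getD` form. -/
theorem soloInformed_idx_getD (β : Fin N → ℕ) {K t : ℕ} (ht : t < K) :
    (soloInformedIdx β K).getD t 0 = soloInformedFib β t := by
  rw [List.getD_eq_getElem?_getD,
    List.getElem?_eq_getElem (by rw [soloInformed_length_idx]; exact ht), Option.getD_some,
    soloInformed_idx_getElem]

/-- **The index words of the final states are `soloInformedHookWords (idx β) pos |bs|`**
(for `pos ≤ K` and pairwise distinct unplaced `bs`). -/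
theorem soloInformed_states_words :
    ∀ (bs : List (Fin N)) (β : Fin N → ℕ) (K pos : ℕ),
      pos ≤ K → (∀ x ∈ bs, K < β x) → bs.Nodup →
      (soloInformedHookStates β K pos bs).map (fun p => soloInformedIdx p.1 (p.2 + 1)) =
        soloInformedHookWords (soloInformedIdx β (K + 1)) pos bs.length
  | [], β, K, pos, _, _, _ => by
    rw [soloInformedHookStates_nil, List.length_nil, soloInformedHookWords_zero,
      List.map_singleton]
  | c :: bs, β, K, pos, hpos, hub, hnd => by
    have hcK : K < β c := hub c (by simp)
    have hcn : c ∉ bs := (List.nodup_cons.1 hnd).1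
    have hnd2 : bs.Nodup := (List.nodup_cons.1 hnd).2
    have hrest : ∀ x ∈ bs, x ≠ c ∧ K < β x := fun x hx =>
      ⟨fun h => hcn (h ▸ hx), hub x (List.mem_cons_of_mem c hx)⟩
    rw [soloInformedHookStates_cons, List.length_cons, soloInformedHookWords_succ,
      soloInformed_length_idx, soloInformed_map_flatMap]
    refine soloInformed_flatMap_congr fun s hs => ?_
    rw [List.mem_range] at hs
    have hs' : pos + s ≤ K := by omega
    have e1 : soloInformedIdx (soloInformedPlIns β c (pos + s)) (K + 1 + 1) =
        (soloInformedIdx β (K + 1)).take (pos + s + 1) ++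
          1 :: (soloInformedIdx β (K + 1)).drop (pos + s + 1) :=
      soloInformed_idx_plIns hcK hs'
    rw [List.map_append,
      soloInformed_states_words bs (soloInformedPlIns β c (pos + s)) (K + 1) (pos + s + 1)
        (by omega) (fun x hx => soloInformed_lt_plIns_of_ne hs' (hrest x hx).1 (hrest x hx).2)
        hnd2,
      soloInformed_states_words bs (soloInformedPlMerge β c (pos + s)) K (pos + s) hs'
        (fun x hx => soloInformed_lt_plMerge_of_ne (hrest x hx).1 (hrest x hx).2) hnd2,
      e1, soloInformed_idx_plMerge hcK hs', soloInformed_idx_getD β (by omega : pos + s < K + 1)]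

/-- **Summary for a fully placed process.** From a partially valid `(β, K, pos)` with
`cum_K(β) + |bs| = N`: the placement sum is the sum of the chain functions of the final states,
each final state is a valid block labelling, and their indices are the words
`soloInformedHookWords (idx β) pos |bs|`. -/
theorem soloInformed_hookSum_final {bs : List (Fin N)} {β : Fin N → ℕ} {K pos : ℕ}
    (hL : soloInformedIsLabK β K) (hpos : pos ≤ K) (hub : ∀ x ∈ bs, K < β x) (hnd : bs.Nodup)
    (hcum : soloInformedCum β K + bs.length = N) (w : Fin N → ℝ) :
    soloInformedHookSum w β K pos bs =
        ((soloInformedHookStates β K pos bs).map (soloInformedStateG w)).sum ∧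
      (∀ p ∈ soloInformedHookStates β K pos bs, soloInformedIsLab p.1 p.2) ∧
      (soloInformedHookStates β K pos bs).map (fun p => soloInformedIdx p.1 (p.2 + 1)) =
        soloInformedHookWords (soloInformedIdx β (K + 1)) pos bs.length :=
  ⟨soloInformed_hookSum_eq_states w bs β K pos,
    fun _ hp => soloInformed_states_isLab hL hpos hub hnd hcum hp,
    soloInformed_states_words bs β K pos hpos hub hnd⟩

end words

/-! ## 3. Sanity checks: the right-hand sides of `HOOK((2),2)`, `HOOK((3),1)`, `HOOK((2,1),1)`

`HOOK((2),2)`: `3·Z(2,1,1) = Z(2,1,1) + Z(2,2) + Z(3,1) + Z(4)`;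
`HOOK((3),1)` (Hoffman): `Z(2,2) + 2·Z(3,1) = Z(3,1) + Z(4)`;
`HOOK((2,1),1)` (Hoffman): `3·Z(2,1,1) = Z(2,1,1) + Z(3,1) + Z(2,1,1) + Z(2,2)` — read with
the left-hand sides of file F5 (linear extensions below the top coordinate). -/

example : soloInformedHookWords [2] 0 2 = [[2, 1, 1], [2, 2], [3, 1], [4]] := by decide

example : soloInformedHookWords [3] 0 1 = [[3, 1], [4]] := by decide

example : soloInformedHookWords [2, 1] 0 1 = [[2, 1, 1], [3, 1], [2, 1, 1], [2, 2]] := by decide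

end Summit.KontsevichZagierPeriods.KontsevichZagierPeriods.Theorems
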